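import Summits.QuantumFields.YangMills.Theorems.FluctuationComparisonRegPrIntLWregChainLaw
import HarnessLib

/-!
# WREG PORT F1c — THE CHAIN'S FORWARD JACOBIAN LAW ON THE ITERATED CENTRAL WINDOW (with and without the CHART-VOL lower bound) and Haar-null
# transport through the chain: images (Lusin N) and preimages on windows (§0d second half of LINE g18-2)

Cell `ym3-torus`, width seat `ym3-torus-px13` g8 (helper of `stmt-QuantumFields-20520` = `UnitScaleTilt.FluctuationComparisonRegPrIntL`, `--supports`,
count-neutral).  PORT of the ideator seat ym-r3-idea-1 g18's map `Cruxes/FluctuationComparisonRegPrIntL/Lines/wreg_chart_port.md` (file F1, split in three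
≤ 400-line modules F1a ∕ F1b ∕ F1c sharing ONE namespace `Summit.QuantumFields.YangMills.Theorems.FluctuationComparisonRegPrIntLWregChain`): a VERBATIM move of lines 981–1131 of the Cruxes workfile
`Cruxes/FluctuationComparisonRegPrIntL/Lines/wreg_chart.lean` v20 (sha16 36befdc7ca5b8719) — `chain_forwardLaw_lb`, `chain_forwardLaw`, `chain_imageNull`, `chain_preimageNull` — so that the organ WREG (`WindowRegularity`) becomes citable BY NAME.
Edits relative to the workfile: namespace, import list (the subset this block uses; NOTHING whose closure contains
`Summits.QuantumFields.BalabanUV.T4Continuum.Support.SubstrateBackground` — the port map's HAZARD), section re-opening at the file seams, and NO heartbeat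
budget (the block elaborates at the default and at 100 000).  Statements, docstrings, proofs: unchanged (credit: ideator ym-r3-idea-1 g14–g18; N09 programme).

HONEST FRAMING.  A port proves nothing new.  WREG is ONE organ of S2β `FluctuationPartSmall`; EXW ∕ GAP ∕ LAPLACE ∕ H4ᶜ ∕ LFR♯ᶜ, the polymer line's stubs,
the run-pair package's seven stubs and the crux `FluctuationComparisonRegPrIntL` (stmt-QuantumFields-20520) are NOT proved; rung R3 = YM₃ on T³ for SU(2) —
NOT d = 4, NOT infinite volume, NOT a mass gap, NOT the Clay problem; nothing of Bałaban's is asserted beyond the cited bookkeeping.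
-/

noncomputable section

open MeasureTheory Filter Topology Set
open scoped ENNReal NNReal
open Literature.MathematicalPhysics.QuantumFieldTheory.Balaban1983to89
open Literature.MathematicalPhysics.QuantumFieldTheory.Balaban1983to89.T4Continuum

namespace Summit.QuantumFields.YangMills.Theorems.FluctuationComparisonRegPrIntLWregChain

section ChainLawSec

open Function
open Literature.MathematicalPhysics.QuantumFieldTheory.Balaban1983to89.BlockAveraging (Idx avgFun measurable_avgFun)
open Literature.MathematicalPhysics.QuantumFieldTheory.Balaban1983to89.BlockAveragingHaarAC (centralBond centralBond_injective isLocal_avgFun pre post)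
open Literature.MathematicalPhysics.QuantumFieldTheory.Balaban1983to89.BlockAveragingEMLHaarAC (fibreFamily offCard)
open Literature.MathematicalPhysics.QuantumFieldTheory.Balaban1983to89.ExpMeanLog (expMeanLogSU deltaSU deltaSU_pos measurable_expMeanLogSU_E)
open Literature.MathematicalPhysics.QuantumFieldTheory.Balaban1983to89.Node00 (SU)
open Summit.QuantumFields.YangMills.BalabanUVNodes.N09CentralWindowAtRecord (avgFun_update_centralBond_injOn_centralWindow mem_injWindow_of_mem_centralWindow)
open Summit.QuantumFields.YangMills.BalabanUVNodes.N09CentralWindowForwardLaw (isClosed_centralWindowW)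
open Summit.QuantumFields.YangMills.BalabanUVNodes.N09CentralWindowForwardLawAtRecord (exists_jacobian_forwardLaws_continuousOn)
open Summit.QuantumFields.YangMills.BalabanUVNodes.N07AveragingLocalContinuity (continuousAt_avgFun_apply_of_small)
open Summit.QuantumFields.YangMills.BalabanUVNodes.N09CentralWindowInverseContinuous (isClosed_centralWindow)
open Literature.Topology.ParametricInverse (continuousOn_of_isClosed_graph)

variable {P : Params}

section ChainLaw

variable {N : ℕ} [NeZero N]

/-- ★★★ **CHART-ALG II** — forward law of the chain (change of variables). [cite: Balaban1987RG1, (0.4) p.253 and (2.10) p.267] -/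
theorem chain_forwardLaw_lb {α : ℝ} (hα0 : 0 ≤ α) (hα24 : α ≤ 1 / 24) (hα64 : 64 * α ≤ deltaSU (Fin N))
    (hαL : 157 * α < ((P.L : ℝ) ^ (P.d - 1))⁻¹)
    (hgap : ∀ j (c : PBond P (j + 1)), (offCard c : ℝ) / (Fintype.card (Idx P) : ℝ) + 150 * α < 1)
    {j₀ : ℝ≥0} (hvol : j₀ = 0 ∨ ChainVol P N α j₀) (n : ℕ) :
    n ≤ P.m + P.K → ∀ c : PBond P n, ∃ J : GaugeField P 0 (SU N) → SU N → ℝ≥0,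
      (Measurable fun p : GaugeField P 0 (SU N) × SU N => J p.1 p.2) ∧
      (∀ U, ∀ g ∈ chainWindow α n U c, J U g ≠ 0) ∧
      (∀ U, (HaarData.haar : Measure (SU N)).restrict (chainMap (expMeanLogSU (n := Fin N)) n U c '' chainWindow α n U c) =
        (((HaarData.haar : Measure (SU N)).restrict (chainWindow α n U c)).withDensity fun g => (J U g : ℝ≥0∞)).map
          (chainMap (expMeanLogSU (n := Fin N)) n U c)) ∧
      (∀ U, ContinuousOn (J U) (chainWindow α n U c)) ∧
      (∀ U g, j₀ ^ n ≤ J U g) := by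
  have hαδ : α < deltaSU (Fin N) := by nlinarith [deltaSU_pos (n := Fin N)]
  induction n with
  | zero =>
      intro _ c
      refine ⟨fun _ _ => 1, measurable_const, fun _ _ _ => one_ne_zero, fun U => ?_, fun U => continuousOn_const, fun U g => by rw [pow_zero]⟩
      have hid : chainMap (expMeanLogSU (n := Fin N)) 0 U c = id := funext fun g => chainMap_zero _ U c g
      have hW0 : chainWindow α 0 U c = Set.univ := rfl
      rw [hid, hW0, Set.image_id, Measure.map_id, Measure.restrict_univ]
      have h1 : (fun _ : SU N => (((1 : ℝ≥0) : ℝ≥0) : ℝ≥0∞)) = 1 := funext fun _ => ENNReal.coe_one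
      rw [h1, withDensity_one]
  | succ n ih =>
      intro hn c
      obtain ⟨J, hJm, hJ0, hJlaw, hJc, hJlb⟩ := ih (by omega) (centralBond c)
      obtain ⟨jac, hjacm, hjac0, hfwd, hjc, hjlb⟩ :=
        exists_jacobian_forwardLaws_lb (N := N) (P := P) (j := n) (by omega) hα0 hα24 hα64 hαL (hgap n) hvol
      have jacm : ∀ (W : GaugeField P n (SU N)), Measurable (jac c W) := fun W =>
        (hjacm c).comp (measurable_const.prodMk measurable_id)
      have hiter := T4Continuum.measurable_iter (fun i => BlockAveraging.blockAvg (P := P) (j := i) (expMeanLogSU (n := Fin N)))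
        (fun j => by rw [BlockAveraging.blockAvg_avg]; exact measurable_avgFun _ measurable_expMeanLogSU_E) n
      refine ⟨fun U g => J U g * jac c (Averaging.iter (fun i => BlockAveraging.blockAvg (P := P) (j := i) (expMeanLogSU (n := Fin N))) n U)
          (chainMap (expMeanLogSU (n := Fin N)) n U (centralBond c) g), ?_, fun U g hg => ?_, fun U => ?_, fun U => ?_,
          fun U g => by rw [pow_succ]; exact mul_le_mul' (hJlb U g) (hjlb c _ _)⟩
      · exact hJm.mul ((hjacm c).comp ((hiter.comp measurable_fst).prodMk (measurable_chainMap₂ n (centralBond c))))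
      · exact mul_ne_zero (hJ0 U g hg.1) (hjac0 c _ _ hg.2)
      rotate_left
      · rw [chainWindow_succ]
        have hf := continuousOn_chainMap (N := N) hαδ (n := n) (by omega) U (centralBond c)
        exact ((hJc U).mono inter_subset_left).mul ((hjc c _).comp (hf.mono inter_subset_left) fun g hg => hg.2)
      · -- `chainMap (n+1) = F ∘ f`, `chainWindow (n+1) = W ∩ f⁻¹ Ω`
        set env : GaugeField P n (SU N) := Averaging.iter (fun i => BlockAveraging.blockAvg (P := P) (j := i) (expMeanLogSU (n := Fin N))) n U
          with henv
        set f := chainMap (expMeanLogSU (n := Fin N)) n U (centralBond c) with hfdef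
        have hcomp : chainMap (expMeanLogSU (n := Fin N)) (n + 1) U c =
            (fun g => avgFun (expMeanLogSU (n := Fin N)) (update env (centralBond c) g) c) ∘ f := funext fun g => chainMap_succ _ hn U c g
        have hW' : chainWindow α (n + 1) U c = chainWindow α n U (centralBond c) ∩ f ⁻¹' centralWindowSet env c α :=
          chainWindow_succ α n U c
        have hFm : Measurable (fun g => avgFun (expMeanLogSU (n := Fin N)) (update env (centralBond c) g) c) :=
          (measurable_pi_apply c).comp ((measurable_avgFun _ measurable_expMeanLogSU_E).comp (measurable_update _))
        have hinjF : InjOn (fun g => avgFun (expMeanLogSU (n := Fin N)) (update env (centralBond c) g) c) (centralWindowSet env c α) :=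
          fun g₁ hg₁ g₂ hg₂ h => avgFun_update_centralBond_injOn_centralWindow (by omega) _ c hα0 hα24 hαδ (hgap n c) hg₁ hg₂ h
        have hFS : MeasurableSet ((fun g => avgFun (expMeanLogSU (n := Fin N)) (update env (centralBond c) g) c) ''
            (f '' chainWindow α n U (centralBond c) ∩ centralWindowSet env c α)) := by
          rw [← Set.image_inter_preimage, ← Set.image_comp, ← hcomp, ← hW']
          exact measurableSet_image_chainWindow hα0 hα24 hαδ hgap hn U c (measurableSet_chainWindow α (n + 1) U c) subset_rfl
        have key := forwardLaw_comp (HaarData.haar : Measure (SU N)) (HaarData.haar : Measure (SU N)) (HaarData.haar : Measure (SU N))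
          (measurable_chainMap n U (centralBond c)) hFm (measurableSet_centralWindowSet env c α)
          (J := fun g => (J U g : ℝ≥0∞)) (jac := fun g => (jac c env g : ℝ≥0∞))
          ((show Measurable (J U) from hJm.comp (measurable_const.prodMk measurable_id)).coe_nnreal_ennreal) (jacm env).coe_nnreal_ennreal
          hinjF hFS (hJlaw U) (hfwd c env)
        have hdens : ((fun g => (J U g : ℝ≥0∞)) * ((fun g => (jac c env g : ℝ≥0∞)) ∘ f)) =
            fun g => ((J U g * jac c env (f g) : ℝ≥0) : ℝ≥0∞) := by
          funext g
          simp only [Pi.mul_apply, Function.comp_apply, ENNReal.coe_mul]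
        rw [hdens] at key
        rw [hcomp, hW']
        exact key

/-- ★★★ **CHART-ALG II with a lower bound** (`J ≥ j₀ⁿ` under `ChainVol`, or `j₀ = 0`). [cite: Balaban1987RG1, (0.4) p.253 and (2.10) p.267] -/
theorem chain_forwardLaw {α : ℝ} (hα0 : 0 ≤ α) (hα24 : α ≤ 1 / 24) (hα64 : 64 * α ≤ deltaSU (Fin N))
    (hαL : 157 * α < ((P.L : ℝ) ^ (P.d - 1))⁻¹)
    (hgap : ∀ j (c : PBond P (j + 1)), (offCard c : ℝ) / (Fintype.card (Idx P) : ℝ) + 150 * α < 1) (n : ℕ) (hn : n ≤ P.m + P.K) (c : PBond P n) :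
    ∃ J : GaugeField P 0 (SU N) → SU N → ℝ≥0,
      (Measurable fun p : GaugeField P 0 (SU N) × SU N => J p.1 p.2) ∧
      (∀ U, ∀ g ∈ chainWindow α n U c, J U g ≠ 0) ∧
      (∀ U, (HaarData.haar : Measure (SU N)).restrict (chainMap (expMeanLogSU (n := Fin N)) n U c '' chainWindow α n U c) =
        (((HaarData.haar : Measure (SU N)).restrict (chainWindow α n U c)).withDensity fun g => (J U g : ℝ≥0∞)).map
          (chainMap (expMeanLogSU (n := Fin N)) n U c)) ∧
      (∀ U, ContinuousOn (J U) (chainWindow α n U c)) := by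
  obtain ⟨J, h1, h2, h3, h4, -⟩ := chain_forwardLaw_lb (N := N) (P := P) hα0 hα24 hα64 hαL hgap (j₀ := 0) (Or.inl rfl) n hn c
  exact ⟨J, h1, h2, h3, h4⟩

/-- ★ **LUSIN (N) ON WINDOWS** (v16): `Haar A = 0`, `A ⊆ window` ⇒ `Haar (chainMap '' A) = 0`. [folklore] -/
theorem chain_imageNull {α : ℝ} (hα0 : 0 ≤ α) (hα24 : α ≤ 1 / 24) (hα64 : 64 * α ≤ deltaSU (Fin N))
    (hαL : 157 * α < ((P.L : ℝ) ^ (P.d - 1))⁻¹)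
    (hgap : ∀ j (c : PBond P (j + 1)), (offCard c : ℝ) / (Fintype.card (Idx P) : ℝ) + 150 * α < 1)
    {n : ℕ} (hn : n ≤ P.m + P.K) (U : GaugeField P 0 (SU N)) (c : PBond P n) {A : Set (SU N)}
    (hA : A ⊆ chainWindow α n U c) (hA0 : (HaarData.haar : Measure (SU N)) A = 0) :
    (HaarData.haar : Measure (SU N)) (chainMap (expMeanLogSU (n := Fin N)) n U c '' A) = 0 := by
  classical
  have hαδ : α < deltaSU (Fin N) := by nlinarith [deltaSU_pos (n := Fin N)]
  obtain ⟨J, -, -, hlaw, -⟩ := chain_forwardLaw (N := N) (P := P) hα0 hα24 hα64 hαL hgap n hn c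
  have hΦm : Measurable (chainMap (expMeanLogSU (n := Fin N)) n U c) := measurable_chainMap n U c
  have hWm : MeasurableSet (chainWindow α n U c) := measurableSet_chainWindow α n U c
  have hA'm : MeasurableSet (toMeasurable HaarData.haar A ∩ chainWindow α n U c) :=
    (measurableSet_toMeasurable _ A).inter hWm
  have hAA' : A ⊆ toMeasurable HaarData.haar A ∩ chainWindow α n U c := fun g hg => ⟨subset_toMeasurable _ A hg, hA hg⟩
  have hA'0 : (HaarData.haar : Measure (SU N)) (toMeasurable HaarData.haar A ∩ chainWindow α n U c) = 0 :=
    measure_mono_null Set.inter_subset_left (by rw [measure_toMeasurable]; exact hA0)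
  have hA'W : toMeasurable HaarData.haar A ∩ chainWindow α n U c ⊆ chainWindow α n U c := Set.inter_subset_right
  have hinj : InjOn (chainMap (expMeanLogSU (n := Fin N)) n U c) (chainWindow α n U c) := chainMap_injOn hα0 hα24 hαδ hgap hn U c
  have himm : MeasurableSet (chainMap (expMeanLogSU (n := Fin N)) n U c '' (toMeasurable HaarData.haar A ∩ chainWindow α n U c)) :=
    hA'm.image_of_measurable_injOn hΦm (hinj.mono hA'W)
  refine measure_mono_null (Set.image_mono hAA') ?_
  have h1 : (HaarData.haar : Measure (SU N)) (chainMap (expMeanLogSU (n := Fin N)) n U c '' (toMeasurable HaarData.haar A ∩ chainWindow α n U c)) =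
      (HaarData.haar : Measure (SU N)).restrict (chainMap (expMeanLogSU (n := Fin N)) n U c '' chainWindow α n U c)
        (chainMap (expMeanLogSU (n := Fin N)) n U c '' (toMeasurable HaarData.haar A ∩ chainWindow α n U c)) := by
    rw [Measure.restrict_apply himm, Set.inter_eq_left.mpr (Set.image_mono hA'W)]
  have h2 : chainMap (expMeanLogSU (n := Fin N)) n U c ⁻¹'
        (chainMap (expMeanLogSU (n := Fin N)) n U c '' (toMeasurable HaarData.haar A ∩ chainWindow α n U c)) ∩ chainWindow α n U c =
      toMeasurable HaarData.haar A ∩ chainWindow α n U c := by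
    ext a
    constructor
    · rintro ⟨⟨a', ha', he⟩, haW⟩
      exact hinj (hA'W ha') haW he ▸ ha'
    · intro ha
      exact ⟨⟨a, ha, rfl⟩, hA'W ha⟩
  rw [h1, hlaw U, Measure.map_apply hΦm himm, withDensity_apply _ (hΦm himm), Measure.restrict_restrict (hΦm himm), h2]
  exact setLIntegral_measure_zero _ _ hA'0

/-- ★ **NULL PREIMAGES ON WINDOWS** (v17): `Haar B = 0` ⇒ `Haar (chainMap⁻¹ B ∩ window) = 0` (`chain_forwardLaw`, `J ≠ 0` on the window). [folklore] -/
theorem chain_preimageNull {α : ℝ} (hα0 : 0 ≤ α) (hα24 : α ≤ 1 / 24) (hα64 : 64 * α ≤ deltaSU (Fin N))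
    (hαL : 157 * α < ((P.L : ℝ) ^ (P.d - 1))⁻¹)
    (hgap : ∀ j (c : PBond P (j + 1)), (offCard c : ℝ) / (Fintype.card (Idx P) : ℝ) + 150 * α < 1)
    {n : ℕ} (hn : n ≤ P.m + P.K) (U : GaugeField P 0 (SU N)) (c : PBond P n) {B : Set (SU N)}
    (hBm : MeasurableSet B) (hB0 : (HaarData.haar : Measure (SU N)) B = 0) :
    (HaarData.haar : Measure (SU N)) (chainMap (expMeanLogSU (n := Fin N)) n U c ⁻¹' B ∩ chainWindow α n U c) = 0 := by
  classical
  obtain ⟨J, hJm, hJne, hlaw, -⟩ := chain_forwardLaw (N := N) (P := P) hα0 hα24 hα64 hαL hgap n hn c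
  have hΦm : Measurable (chainMap (expMeanLogSU (n := Fin N)) n U c) := measurable_chainMap n U c
  have hWm : MeasurableSet (chainWindow α n U c) := measurableSet_chainWindow α n U c
  have hJU : Measurable fun g => (J U g : ℝ≥0∞) := (hJm.comp (measurable_const.prodMk measurable_id)).coe_nnreal_ennreal
  have h1 : ∫⁻ g in chainMap (expMeanLogSU (n := Fin N)) n U c ⁻¹' B ∩ chainWindow α n U c, (J U g : ℝ≥0∞) ∂(HaarData.haar : Measure (SU N)) = 0 := by
    have h : (HaarData.haar : Measure (SU N)).restrict (chainMap (expMeanLogSU (n := Fin N)) n U c '' chainWindow α n U c) B =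
        ((((HaarData.haar : Measure (SU N)).restrict (chainWindow α n U c)).withDensity fun g => (J U g : ℝ≥0∞)).map
          (chainMap (expMeanLogSU (n := Fin N)) n U c)) B := by rw [hlaw U]
    rw [Measure.restrict_apply hBm, Measure.map_apply hΦm hBm, withDensity_apply _ (hΦm hBm), Measure.restrict_restrict (hΦm hBm)] at h
    rw [← h]
    exact measure_mono_null Set.inter_subset_left hB0
  have hSm : MeasurableSet (chainMap (expMeanLogSU (n := Fin N)) n U c ⁻¹' B ∩ chainWindow α n U c) := (hΦm hBm).inter hWm
  rw [lintegral_eq_zero_iff' (hJU.aemeasurable.restrict), Filter.EventuallyEq, ae_restrict_iff' hSm] at h1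
  rw [← compl_mem_ae_iff]
  filter_upwards [h1] with g hg
  intro hgS
  have h0 := hg hgS
  rw [Pi.zero_apply, ENNReal.coe_eq_zero] at h0
  exact hJne U g hgS.2 h0

end ChainLaw


end ChainLawSec

end Summit.QuantumFields.YangMills.Theorems.FluctuationComparisonRegPrIntLWregChain

end
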